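import Summits.ABC.IUTFork.Cor312UnionCoverThm311
import Summits.ABC.IUTFork.Charitable.Thm311D2Derive
import HarnessLib

/-!
# [IUTchIII] Thm. 3.11, team D2's charitable typing — the UNION RUNG (R∪) and the UNION-COVER bed P♮∪

Proof-only file (D-0012; no definition, no `Prop` fact) of the abc-iut cell, branch D, team D2 (seat abc-iut-D2-typ gen 11, TEAM ANCHOR;
rung LADDER-ABC:A2.D; CHARITY-D2.md §11 «RUNG LATTICE», additive row (R∪)). It records team D2's kernel column for abc-iut-rp-j1's UNION-COVER
bed P♮∪ (`Cor312UnionCoverThm311`, p451547: plane shells, Ism read as the stabiliser of `ℤ²` — the bed's one disclosed reading choice — under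
which the q-pilot region IS the UNION of the possible images of the Θ-pilot, `UnionWitness.qRegion_eq_sUnion_possibleImages`, while it is no
single possible image and `S := PilotKummerIndRelated` FAILS, `UnionWitness.uSetting_not_pilotKummerIndRelated`). PROVED HERE:
* §1 at P♮∪ team D2's Parts (i), (ii) and (iii)-minus-the-square HOLD (`union_partI_partII`, `union_partIII_minus_square`), so AT THE BED the
  typing IS its square: `Thm311Charitable_2 ⟺ III_c_KummerLinkSquare` at every column and every `qK` (`union_charitable_2_iff_square`); the square
  FAILS at the bed's q-datum at EVERY column (`union_not_square`), hence so do `Thm311Charitable_2` (`union_not_charitable_2`) and the inline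
  `PilotKummerCompat` (`union_not_pilotKummerCompat`) — team D2's typing fails at P♮∪ EXACTLY at its one clause graded STRONGER-THAN-PRINT, the
  same single locus as at the pinned model M, the flipped split bed and teams D3/D4's beds (CHARITY-D2.md §12/§16);
* §2 MODEL-FREE: the UNION RUNG «at every `(j, v_ℚ)` the q-pilot region equals the union of the possible images» implies the hull-level
  `Thm311ToCor312.Licence` and hence, under the bridge hypotheses, the printed Statement of Cor. 3.12 (`licence_of_unionRung`,
  `statement_of_unionRung`);
* §3 CLOSED FORM «(R∪) ⊬ S»: it is NOT the case that the typed Thm. 3.11 ∧ bridge hypotheses ∧ `|log(q)| > 0` ∧ the three pins ∧ the UNION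
  RUNG ∧ the printed Statement give `S` (`unionRung_not_imp_S`, witness P♮∪ at `p = 2`). In the rung lattice: (R∪) ⟹ hull ⟹ Statement (at P♮∪
  with EQUALITY), never `S`; (R∪) ∧ ¬(reading R3) at P♮∪, so (R∪) does not imply the single-translate reading (the converse separation is not built).
Every IUT noun [claim: Mochizuki2012, status: disputed]; locates / conditionally verifies; no abc claim; no side taken on [IUTchIII] Cor. 3.12 or on
any author (Mochizuki / Scholze–Stix / Joshi / Dupuy–Hilado); typed ≠ proved. [cite: DupuyHilado2020, §6.2] [cite: ScholzeStix2018, §2.2 pp. 9–10]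
-/

noncomputable section

open Set

namespace Summit.ABC.IUTFork.Charitable.D2

open Thm311 Cor312 Cor312.Checks Cor312Vol Cor312Vol.UnionWitness Literature.IUT.LogThetaLattice

variable (p : ℕ)

/-! ## 1. Team D2's typing at the UNION-COVER bed P♮∪ -/

/-- Team D2's Parts (i) and (ii) HOLD at P♮∪'s situation: Step (x) admissibility transport and log-volume invariance for the generators
(`UnionWitness.uAdm_image_iff`, `uVol_image`), degrees by the one-place `finsum`, all columns' data equal (permutation symmetry by reflexivity),
identity Kummer transport, (Ind3) as `Λ_j ⊆ Λ_j`. [folklore] -/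
theorem union_partI_partII [Fact p.Prime] : PartI (uFull p).toLatticeSituation ∧ PartII (uFull p).toLatticeSituation :=
  ⟨⟨fun _ => ⟨fun Φ hΦ j vQ A hA => uVol_image (Subgroup.subset_closure hΦ) hA, fun Φ hΦ j vQ B => uAdm_image_iff (Subgroup.subset_closure hΦ) B⟩,
    fun _ j _ => ⟨fun vQ => Or.inl ⟨0, (ball_zero p _ vQ).symm⟩, Set.toFinite _, by
      show uVol p j.1 () (latt j.1 ()) = ∑ᶠ vQ : toyIndex.VQ, uVol p j.1 vQ (latt j.1 vQ)
      rw [finsum_unique]; rfl⟩,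
    fun _ _ => Relation.EqvGen.refl _⟩,
   ⟨fun _ _ _ _ _ => ⟨Iff.rfl, fun _ => rfl⟩, ⟨fun _ _ _ _ _ => subset_rfl, fun _ _ _ _ _ => subset_rfl⟩, fun _ _ _ _ => rfl,
    fun _ _ _ => rfl⟩⟩

/-- (iii)(a)(b), the (iii)(c) gloss and (iii)(d) HOLD at P♮∪'s situation (`Φ = 1`). [folklore] -/
theorem union_partIII_minus_square : III_ab_UnitPortionLink (uFull p).toLatticeSituation ∧
    III_c_Stabilized (uFull p).toLatticeSituation ∧ III_d_NumberFieldLink (uFull p).toLatticeSituation :=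
  ⟨fun _ => ⟨1, one_mem _, fun _ _ => (Set.image_id _).symm⟩, III_c_Stabilized_holds _,
    fun _ => ⟨1, one_mem _, fun j => (Set.image_univ_of_surjective (plane.globalAut 1 j.1).surjective).symm⟩⟩

/-- **AT THE BED team D2's typing IS its square**: `Thm311Charitable_2 ⟺ III_c_KummerLinkSquare`, at every column `n` and for every bad-place
datum `qK`. [folklore] -/
theorem union_charitable_2_iff_square [Fact p.Prime] (n : ℤ) (qK : ∀ v : toyIndex.V, v ∈ toyIndex.Vbad → Set (plane.StarPacket v)) :
    Thm311Charitable_2 (uFull p).toLatticeSituation n qK ↔ III_c_KummerLinkSquare (uFull p).toLatticeSituation n qK :=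
  ⟨fun h => (charitable_2_square _ h).2.2, fun h => ⟨(union_partI_partII p).1, (union_partI_partII p).2,
    (union_partIII_minus_square p).1, (union_partIII_minus_square p).2.1, h, (union_partIII_minus_square p).2.2⟩⟩

/-- **The square FAILS at the q-datum of P♮∪, at EVERY column** (the columns are identical): else `S` by team D2-prv's (a-min)
`pilotKummerIndRelated_of_square`, against `UnionWitness.uSetting_not_pilotKummerIndRelated`. [folklore] -/
theorem union_not_square [Fact p.Prime] (n : ℤ) : ¬ III_c_KummerLinkSquare (uFull p).toLatticeSituation n (qDatumU p) := fun h =>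
  uSetting_not_pilotKummerIndRelated p
    (pilotKummerIndRelated_of_square _ (uSetting p) (ptRegion p) (qDatumU p) (union_partI_partII p).1.2.2 (union_partI_partII p).2.2.2.1
      (by obtain ⟨Φ, hΦ, m, h⟩ := h; exact ⟨Φ, hΦ, m, h⟩))

/-- **Team D2's charitable typing FAILS at P♮∪ — EXACTLY at `III_c_KummerLinkSquare`** (by `union_charitable_2_iff_square` and `union_not_square`),
at every column. [folklore] -/
theorem union_not_charitable_2 [Fact p.Prime] (n : ℤ) : ¬ Thm311Charitable_2 (uFull p).toLatticeSituation n (qDatumU p) := fun h =>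
  union_not_square p n ((union_charitable_2_iff_square p n _).1 h)

/-- … and the inline `Cor312Vol.PilotKummerCompat` (= the square at the setting's column under I-perm ∧ II-b, `square_of_pilotKummerCompat`)
FAILS at P♮∪. [folklore] -/
theorem union_not_pilotKummerCompat [Fact p.Prime] : ¬ PilotKummerCompat (uFull p).toLatticeSituation (uSetting p) (qDatumU p) := fun h =>
  union_not_square p _ (square_of_pilotKummerCompat _ (uSetting p) (qDatumU p) (union_partI_partII p).1.2.2 (union_partI_partII p).2.2.2.1 h)

/-! ## 2. The UNION RUNG (R∪), model-free: ⟹ `Licence` ⟹ the printed Statement -/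

/-- **(R∪) ⟹ `Licence`**: if at every `(j, v_ℚ)` the q-pilot region IS the union of the possible images of the Θ-pilot, then it lies in the
holomorphic hull `ⁿ˒°𝒰_{j,v_ℚ}` of that union (a hull contains its set, `HullFrame.subset_hull`). [claim: Mochizuki2012, status: disputed] -/
theorem licence_of_unionRung {T : ThetaIndex} {S : Situation T} (P : Setting S)
    (h : ∀ (j : T.Label) (vQ : T.VQ), P.qRegion j vQ = ⋃₀ P.possibleImages j vQ) : Thm311ToCor312.Licence P := fun _ vQ =>
  (h _ vQ).subset.trans ((P.frame _ vQ).subset_hull _)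

/-- **(R∪) ⟹ the printed Statement of Cor. 3.12** under the bridge hypotheses (`Thm311ToCor312.statement_of_licence`: monotonicity of the
log-volume). [claim: Mochizuki2012, status: disputed] -/
theorem statement_of_unionRung {T : ThetaIndex} {S : Situation T} (P : Setting S) (H : BridgeHyps P)
    (h : ∀ (j : T.Label) (vQ : T.VQ), P.qRegion j vQ = ⋃₀ P.possibleImages j vQ) : P.Statement :=
  Thm311ToCor312.statement_of_licence H (licence_of_unionRung P h)

/-! ## 3. (R∪) ⊬ S — closed form -/

/-- **UNION RUNG ⊬ S, closed form.** It is NOT the case that, over every index, full situation, setting, region operator and q-datum, the typed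
Thm. 3.11 ∧ the bridge hypotheses ∧ `|log(q)| > 0` ∧ the three pins ∧ the UNION RUNG ∧ the printed Statement give `S := PilotKummerIndRelated`:
witness abc-iut-rp-j1's P♮∪ at `p = 2` (`uFull_statement`, `uSetting_bridgeHyps`, `uSetting_absLogQPos`, `uSetting_pinnedRegions3`,
`qRegion_eq_sUnion_possibleImages`, `uSetting_statement`, `uSetting_not_pilotKummerIndRelated`). In team D2's rung lattice (CHARITY-D2.md §11):
(R∪) ⟹ hull ⟹ Statement, never `S`; only the single-translate square `III_c_KummerLinkSquare` reaches `S`. [claim: Mochizuki2012, status: disputed] -/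
theorem unionRung_not_imp_S :
    ¬ ∀ (T : ThetaIndex) (F : FullSituation T) (P : Setting F.toLatticeSituation.toSituation)
        (ρ : (∀ v : T.V, v ∈ T.Vbad → Set (F.L.StarPacket v)) → ∀ (j : T.Label) (vQ : T.VQ), Set (F.L.Packet j vQ))
        (qK : ∀ v : T.V, v ∈ T.Vbad → Set (F.L.StarPacket v)),
        F.Statement → BridgeHyps P → P.AbsLogQPos → PinnedRegions3 F.toLatticeSituation P ρ qK →
          (∀ (j : T.Label) (vQ : T.VQ), P.qRegion j vQ = ⋃₀ P.possibleImages j vQ) → P.Statement →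
            PilotKummerIndRelated F.toLatticeSituation P ρ qK := fun h => by
  haveI : Fact (Nat.Prime 2) := ⟨Nat.prime_two⟩
  exact uSetting_not_pilotKummerIndRelated 2
    (h toyIndex (uFull 2) (uSetting 2) (ptRegion 2) (qDatumU 2) (uFull_statement 2) (uSetting_bridgeHyps 2) (uSetting_absLogQPos 2)
      (uSetting_pinnedRegions3 2) (qRegion_eq_sUnion_possibleImages 2) (uSetting_statement 2).1)

/-- (R∪) and ¬(reading R3) hold together at P♮∪ (`p` prime): the union rung does NOT imply the single-translate reading «q-region ∈ possible
images». [folklore] -/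
theorem unionRung_and_not_reading3 [Fact p.Prime] :
    (∀ (j : toyIndex.Label) (vQ : toyIndex.VQ), (uSetting p).qRegion j vQ = ⋃₀ (uSetting p).possibleImages j vQ) ∧
      ¬ ∀ (j : toyIndex.Label) (vQ : toyIndex.VQ), (uSetting p).qRegion j vQ ∈ (uSetting p).possibleImages j vQ :=
  ⟨qRegion_eq_sUnion_possibleImages p, uSetting_not_reading3 p⟩

end Summit.ABC.IUTFork.Charitable.D2

end
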